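import Mathlib
import HarnessLib
import HarnessLib.Audit
import Summits.NavierStokesRegularity.Statement
import Literature.Analysis.FluidPDE.ClassicalSolution
import Literature.Analysis.FluidPDE.LerayHopf
import Literature.Analysis.FluidPDE.NSWave0
import Literature.Analysis.FluidPDE.LocalLeraySolutions
import Summits.NavierStokesRegularity.NavierStokesRegularity.Theorems.TypeICertificateLadderNoBlowupToClay
import HarnessLib.Audit.Status.Attr

/-!
Route: SubcubicESS

DORMANT since 2026-09-01T12:17:15Z (reconciler: no traction for 5 d (last activity statement-checked at 2026-08-27T11:18:52Z); parked, not closed — `ledger route dormant route-NavierStokesRegularity-SubcubicESS --off` to reactivate) — unstaffed, not closed; items shared with open routes are served there. `ledger route dormant <id> --off` reactivates.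

# Route SubcubicESS — NavierStokesRegularity (Clay A), positive side: THE CUBIC THRESHOLD (card
NavierStokesRegularity/NavierStokesRegularity/subcubic-ess-bridge)

## Thesis X = SubcubicBound ("it suffices to show")
In words: Tao's quantitative Escauriaza–Seregin–Šverák function is SUB-CUBIC. There is F : ℝ → ℝ
with F(A) = o(A³) (A → ∞) such that every classical solution of unforced Navier–Stokes (ν = 1) on
[0,T] × ℝ³ in Tao's class (all ‖∇ⁿu(t)‖_{L²} bounded on [0,T]) with sup_{0≤t≤T} ‖u(t)‖_{L³} ≤ A, A ≥
2, obeys |u(t,x)| ≤ F(A) t^{-1/2} for 0 < t ≤ T. Known: F(A) = exp exp exp(A^{O(1)})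
(Tao2021QuantitativeNS = arXiv:1908.04958, Thm 1.2; in tree
`Literature.Analysis.FluidPDE.tao_quantitative_ess`).
Lean (elaborates, Sketch.lean rc 0):
  ∃ F : ℝ → ℝ, (∀ ε : ℝ, 0 < ε → ∃ A₀ : ℝ, ∀ A : ℝ, A₀ ≤ A → F A ≤ ε * A ^ 3) ∧ ∀ (T A : ℝ) u p,
Literature.Analysis.FluidPDE.IsHkClassicalSolutionOn (Set.Icc 0 T) u p → (∀ t ∈ Set.Icc 0 T,
MeasureTheory.eLpNorm (u t) 3 MeasureTheory.volume ≤ ENNReal.ofReal A) → 2 ≤ A → ∀ t ∈ Set.Ioc 0 T,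
∀ x, ‖u t x‖ ≤ F A * t ^ (-(1/2 : ℝ))

## Why X suffices (the bridge = one Hölder line against the energy)
For a finite-energy classical solution from a rapidly decaying datum on [0,T*): ‖u(t)‖₃³ ≤ ‖u(t)‖₂²
‖u(t)‖_∞ ≤ 2E(u₀) ‖u(t)‖_∞ — the energy pays for exactly THREE powers of the critical norm. Put N(t)
= sup_{s≤t} ‖u(s)‖₃, t₀ = T*/2, rescale to ν = 1 (w(s,x) = ν⁻¹u(s/ν,x), template
`norm_le_of_tao_quantitative`) and apply X on the closed slab [0,t] (Tao class there by the PROVED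
`tao2011_hasBoundedSobolevNormsOn_holds`): with A = max(2, ν⁻¹N(t)) one gets (ν⁻¹N(t))³ ≤
max((ν⁻¹N(t₀))³, 8, K·F(A)), K = 2E(u₀) ν^{-5/2} t₀^{-1/2}. F = o(A³) (take ε = 1/(2K)) bounds N(t)
uniformly for t < T*; the L³ continuation criterion then extends u past T*. That criterion is
`Literature.Analysis.FluidPDE.hasSmoothExtensionPast_of_eLpNorm_three_bounded`, PROVED in tree from
Tao's theorem (`hasSmoothExtensionPast_of_eLpNorm_three_bounded_of_tao2021`,
NSCriticalClosureTao2021.lean) by an argument that reads only the velocity clause `.1` — hence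
provable from ANY uniform velocity bound F(A) (support UniformESSClosure). NoBlowup → Clay (A) is
the shared assembly stmt-NavierStokesRegularity-0055.
Conversely any finite-time blow-up forces F(A) ≥ A³/K for all large A along N(t) ↑ ∞ (Seregin2012):
the exponent 3 is a two-sided DICHOTOMY threshold. The whole route therefore lives in the gap
"triple exponential (known) — sub-cubic (sufficient)" of ONE universal function, F_*(A) := sup {
t^{1/2}‖u(t)‖_∞ : Tao-class solutions with L^∞_t L³_x-history ≤ A }.

## Assembly X → NavierStokesRegularity (pure logic; `assembly_proof` in Sketch.lean)
SubcubicBound → EnergyBridge → UniformESSClosure → (NoBlowup → NavierStokesRegularity) →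
NavierStokesRegularity, where EnergyBridge := X → (every classical Leray–Hopf solution from a
rapidly decaying datum on [0,T) has ⨆_{t<T} ‖u(t)‖₃ < ⊤) and UniformESSClosure := (∃ F, uniform
velocity ESS bound in Tao's class) → hasSmoothExtensionPast_of_eLpNorm_three_bounded. Both supports
are provable NOW against proved tree facts (tao2011_hasBoundedSobolevNormsOn_holds,
linfty_bound_of_hasBoundedSobolevNormsOn_holds, IsLerayHopfOn.lintegral_enorm_sq_le,
IsClassicalNSSolutionOn.viscosityRescale_zero, tao2011_smooth_local_existence_holds,
serrin_weak_strong_uniqueness_holds); no unproved named fact enters the import cone except through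
the crux X itself.

## Two-layer plan (D-0019)
Layer 1 (now): cruxes #2–#5 below + the two glue supports + shared 0055 + assembly. Layer 2 (only
after a crux closes or is stamped): split X along Tao's proof (arXiv:1908.04958 Rmk 1.5: one
exponential each from Bourgain energy pigeonholing, from the Carleman inequalities, from counting
disjoint scales) into polynomial-cost replacements; the self-similar rung #5 splits into far field
(Barker–Prange arXiv:2003.06717 Thm 3, already polynomial: C_*M⁸N¹⁹, S_* ~ M^{-30}N^{-70}) +
near-field elliptic bootstrap for the Leray system.

Rationale: WHY THIS LINE. Barker–Prange (arXiv:2003.06717 §1.2) frame quantitative regularity as ‖u‖_{L∞(½,1)}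
≤ G(‖u‖_X) and note that for LARGE critical norms "a scaling argument does not provide a suitable
candidate for G" (known: G = exp(cA⁵) for L⁵_{t,x}, exp exp exp(A^C) for L∞_tL³_x, Tao 1908.04958
Thm 1.2; exp exp in Palasek's axisymmetric class 2101.08586 Thm 1). The card's observation supplies
the candidate from OUTSIDE the critical theory: interpolating the critical L³ norm between the
ENERGY (supercritical, a priori bounded) and L∞ (what ESS outputs) closes a bootstrap exactly when G
is sub-cubic, and for L^q_tL^r_x classes the same line gives threshold r/(r−2) (5/3 for L⁵; 1 —
impossible — at L²_tL∞_x), so L∞_tL³_x is the endpoint with the most room. Clay (A) thus becomes a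
question about the SIZE of one true theorem (ESS), i.e. analysis of bounded-critical-norm solutions,
where backward uniqueness/unique continuation — the evasion Tao2016 names for the averaged-equation
barrier — is available and fully quantitative (Carleman). Imported: quantitative unique continuation
(Tao 2021, Barker–Prange 2021), turbulence phenomenology only as heuristics for the size of F_*
(linear regime F~A; one strained Burgers level F~A^{3/2}; n nested constant-Reynolds levels
F~A^{1+n/2}: cubic = depth 4). No probabilistic/spectral reformulation: the object is a single real
function F_*.
RANKED CRUXES. #2 SubcubicBound (X; hardest; why fail: F_* may be ≥ A³ — nothing beyond F_* ≳ A is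
known from below, and depth-≥5 constant-Re nested strained structures, if dynamically sustainable
for the parent viscous time, give A^{7/2}; Tao Rmk 1.5: 'substantially new ideas needed' even for
one exponential). #3 PolynomialBound (∃ C k: F ≤ C A^k; the natural milestone; why fail: Carleman
across an annulus costs exp of the L³ profile — exponent-free unique continuation (frequency
function/doubling) is not available for NS). #4 AxisymSubcubicBound (X in the axisymmetric class;
Palasek: exp exp; via the same bridge + `IsTaoSolutionOn.conj_eq_of_datum` it would settle
`Literature.Analysis.FluidPDE.AxisymmetricSwirlRegularity`; why fail: KNSS: axisymmetric
singularities are Type II with diverging L³, so no cheap exclusion, and Hou's scenario 2107.06509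
lives here). #5 SelfSimilarSubcubicBound (toy rung = Jia–Šverák 1204.0529 Thm 4.1 quantified:
self-similar local Leray solutions with |x||u₀(x)| ≤ A have t^{1/2}‖u(t)‖_∞ = ‖U‖_∞ ≤ F(A), F =
o(A³); Jia–Šverák's C(M) is untracked, Korobkov–Tsai-type a-priori bounds are by contradiction; a
POLYNOMIAL bound looks reachable from Barker–Prange 2003.06717 Thm 3 + local energy inequality +
elliptic bootstrap — sub-cubic is the real question; why fail: large-data profile branches bifurcate
(JiaSverak2015, GuillodSverak2023) and near-field L²(B₁)-mass up to A² is allowed by the local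
energy inequality).
SUPPORT (provable now). EnergyBridge (X → sup_{[0,T)}‖u‖₃ < ⊤; ~150 lines on the
NSCriticalClosureTao2021 template). UniformESSClosure (∃F velocity ESS → L³ criterion; copy of
`…_of_tao2021'` with taoTripleExp C ↦ F, only `.1` is read). NoBlowupToClay = stmt-0055 (shared).
Assembly = pure logic (proved in Sketch.lean).
KILL CRITERIA. (K1) A family of Tao-class solutions with L∞_tL³-history ≤ A_n → ∞ and
t^{1/2}‖u(t)‖_∞ ≥ cA_n³ refutes X (route BROKEN; no repair reaches Clay (A) since the energy buys
exactly three powers) — close `refuted:SubcubicBound` with the census 'quantitative ESS cannot reach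
(A) through the energy'; cheapest searches: nested strained-tube configurations with ≥ 5 levels;
Kang–Yun–Protas-type adjoint optimisation (1909.00041) of t^{1/2}‖u(t)‖_∞ under an L∞_tL³
constraint. (K2) #5 refuted (super-cubic self-similar profiles) does not kill X (infinite energy,
weak-L³) but downgrades it to implausible: re-rank. (K3) NoBlowup (stmt-0054) proved elsewhere moots
the route; a Type-II blow-up (¬0054) kills it with everything else.
NOT DECOMPOSED (deliberately). How X/#3 would be proved (frequency-localised ε-regularity along
Tao's bubble chain with polynomial losses; Gaussian-free backward uniqueness); the liminf sharpening
(liminf F_*(A)/A³ = 0 already suffices, via continuity of t ↦ sup_{s≤t}‖u(s)‖₃) and the converse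
'blow-up ⇒ F_* ≥ cA³' as formal items; the weak-L³/Lorentz variant (Tao Rmk 1.6); the axisymmetric
assembly to AxisymmetricSwirlRegularity; the polynomial (any exponent) version of #5 as a support
item — each is filed when its parent is stamped or closes.
NUMBERS. Known F: exp exp exp(A^{O(1)}), C₀ = 10⁵ suffices in exponents (Tao p.6); axisymmetric exp
exp(A^{O(1)}) (Palasek Thm 1); Type-I class: L³ rate (log 1/(T*−t))^{?}/exp exp(M^{1025})
(Barker–Prange Thm 1); lower bound F_*(A) ≥ cA (heat flow of an L³-normalised bump). Threshold
needed: 3. Items at open: 8 (4 cruxes, 3 support incl. shared 0055, assembly; no separate target — X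
is crux #2).
NOVELTY / BARRIERS: see the dedicated sections (passed with --novelty/ --barriers).

Novelty: NOVELTY (planner, 2026-08-15; on top of two refuter audits of the card, grade new-combination,
10:23Z). Searched today: `lit read arXiv:1908.04958` pp.2,6 (Thm 1.1/1.2, Rmk 1.5: exponentials from
Bourgain pigeonholing / Carleman / scale counting, 'substantially new ideas would be needed'; Rmk
1.6 Lorentz variants) — no statement that any power < 3 (or any polynomial) would settle regularity;
`lit read arXiv:2003.06717` (Barker–Prange CMP 2021) §1.2 pp.7-8: the general form ‖u‖_{L∞(½,1)} ≤
G(‖u‖_X), 'for large scale-invariant norms it is less clear what the candidate for G might be', G =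
exp(cx⁵) for L⁵ via enstrophy-Gronwall, improving it 'would most likely require a nonlinear
mechanism that reduces vortex stretching' — nearest printed discussion, NO energy-anchored
threshold; same paper Thm 3 p.26 (quantified Jia–Šverák local smoothing, polynomial C_*M⁸N¹⁹,
S_*=O(1)M^{-30}N^{-70}) = the tool for rung #5; `lit read arXiv:2101.08586` p.4 (Palasek Thm 1: exp
exp(A^{O(1)}) for axisymmetric L∞_tL³ — source for rung #4); `lit read arXiv:1204.0529` p.9
(Jia–Šverák Thm 4.1: a-priori bound C(M) for self-similar profiles via local energy inequality +
local-in-space regularity, constants untracked — source for rung #5); `lit search --source s2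
'Barker Prange quantitative regularity Navier-Stokes'` (12 rows: 2003.06717, 2211.16215 survey,
2012.09776 mild criticality breaking, 2510.20757, 2209.15627, 2302.06509, 2101.08586, 1812.09115,
2602.09951, 2501.15243 — none states a polynomial/cu  [refs: 1908.04958, 2003.06717, 2101.08586, 1204.0529, 2605.01873]

Barriers (technique_class: sup-type-critical-norm-regularity-criterion energy-methods): BARRIERS (catalogue Literature/Barriers/NavierStokesRegularity: 18 entries listed, 8 read; negatives
index: 0 refuted statements on 2026-08-15; technique_class:
sup-type-critical-norm-regularity-criterion energy-methods).
- Literature.Barriers.NavierStokesRegularity.EnergySupercriticality: RESPECTED, not evaded — the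
energy is used once, as the supercritical anchor of ‖u‖₃³ ≤ ‖u‖₂²‖u‖_∞; the bridge quantifies
exactly how much critical information the energy class buys (three powers of A) and imports ALL
critical control from the crux X, a statement about solutions already bounded in the critical norm,
where this barrier is silent. No coercive supercritical quantity is asked to control a critical one.
- Literature.Barriers.NavierStokesRegularity.TaoAveragedBlowup: the bridge (Hölder + energy
inequality + L³-criterion shape) is abstract and WOULD hold verbatim for Tao's averaged bilinear B̃,
so it relocates all content into X; for B̃ the analogue of X must fail (its blow-up is Type II with
diverging critical norms, arXiv:1402.0290 p.8; even the qualitative L³ criterion is unknown for B̃).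
Any proof of X or of rung PolynomialBound must run on backward uniqueness / unique continuation
through the vorticity equation (Carleman; Tao arXiv:1908.04958 §4, Barker–Prange arXiv:2003.06717),
which Tao2016 §1.1 lists as 'not manifestly subject' to averaging. Bet, stated honestly: the
exponentials in F are artefacts of pigeonholing and Gaussian Carleman weights, not of the dynamics.
- Liter

History (route lifecycle, newest last):
- 2026-08-15T16:20:58Z · rev 3: restated SubcubicBound (stmt-NavierStokesRegularity-1168), PolynomialBound (stmt-NavierStokesRegularity-1169), AxisymSubcubicBound (stmt-NavierStokesRegularity-1170), SelfSimilarSubcubicBound (stmt-NavierStokesRegularity-1171), EnergyBridge (stmt-NavierStokesRegularity-1172), UniformESSClosure (stmt-NavierStokes (planner-rbadge-NavierStokesRegularity-Subcubic-4eab406a-g2-0)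
- 2026-08-22T07:31:43Z · DORMANT — reconciler: no traction for 5.2 d (last activity item-evidence-added at 2026-08-17T02:50:57Z); parked, not closed — `ledger route dormant route-NavierStokesRegu (operator:999:2124451)
- 2026-08-27T03:05:23Z · REACTIVATED — reconciler: reactivated — activity statement-closed at 2026-08-27T01:49:21Z after parking at 2026-08-22T07:31:43Z (operator:999:2469592)
- 2026-09-01T12:17:15Z · DORMANT — reconciler: no traction for 5 d (last activity statement-checked at 2026-08-27T11:18:52Z); parked, not closed — `ledger route dormant route-NavierStokesRegulari (operator:999:3792709)

sub-problem: NavierStokesRegularity · status: dormant · opened planner-plancard-NavierStokesRegularity-Navie-87614202-0 2026-08-15T10:53:05Z · rev 5 · ledger route-NavierStokesRegularity-SubcubicESS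
GENERATED by the gate from the ledger (D-0016/17). Provers cite these decls: `theorem foo : Summit.NavierStokesRegularity.NavierStokesRegularity.Theses.SubcubicESS.<Decl> := …` in Summits/NavierStokesRegularity/NavierStokesRegularity/Theorems/<Name>.lean.
-/

namespace Summit.NavierStokesRegularity.NavierStokesRegularity.Theses.SubcubicESS

open scoped BigOperators Topology Manifold Classical MeasureTheory ProbabilityTheory Matrix InnerProductSpace ComplexConjugate ContinuousMap
open Filter Set Function TopologicalSpace MeasureTheory

attribute [summit_statement] _root_.NavierStokesRegularity

open Literature.NS

-- earlier SubcubicBound (stmt-NavierStokesRegularity-1168, replaced 2026-08-15T16:20:58Z -> stmt-NavierStokesRegularity-10671): retired by None — ∃ F : ℝ → ℝ, (∀ ε : ℝ, 0 < ε → ∃ A₀ : ℝ, ∀ A : ℝ, A₀ ≤ A → F A ≤ ε * A ^ 3) ∧ ∀ (T A : ℝ) (u : ℝ → EuclideanSpace ℝ (Fin 3) → EuclideanSpace ℝ (Fin 3)) (p : ℝ → EuclideanSpace ℝ (Fin 3) → ℝ), Literature.Analysis.FluidPDE.IsHkClassicalSolutionOn (Set.Icc 0 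
/-- item stmt-NavierStokesRegularity-10671 · crux · rank 2 · open · by planner
why it might fail: F_* may be ≥cA³ — X can fail even if Clay (A) holds (transient amplification at bounded L³); any finite-energy blow-up (e.g. Hou's axisymmetric scenario, if real) forces F_*(A)≥A³/K for all large A via the bridge; cascade depth≥5 gives A^{7/2}; known above: only exp exp exp(A^C) (Tao Thm 1.2).
sources: Tao2021QuantitativeNS = arXiv:1908.04958: Thm 1.2 (p.2); Rmk 1.5 (p.6: one exp each from Bourgain pigeonholing / Carleman / counting disjoint scales; 'substantially new ideas would be needed'); C0 = 10^5 (p.6), arXiv:2003.06717 sec.1.2 p.7 (Barker-Prange CMP 2021: 'a scaling argument does not provide a suitable candidate for G' for critical norms), arXiv:2602.09951 p.2 (Feb 2026: t^{-1/2} exp exp exp(M^c) still quoted as the L^inf_t L^3_x estimate; refinements listed are localisations/concentration, not smaller towers), Hou2022PotentiallySingularNS = arXiv:2107.06509 (candidate axisymmetric interior blow-up: would force F_* ≥ cA³ through the bridge), Tao2016AveragedNS = arXiv:1402.0290 (cascade archetype; the bridge holds verbatim for the averaged equation, whose analogue of X fails), Literature.Analysis.FluidPDE.tao_quantitative_ess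
[crux] X (thesis): Tao's quantitative ESS function is SUB-CUBIC, F(A)=o(A^3): every Tao-class (all
Sobolev norms bounded) classical solution of unforced NS, nu=1, on [0,T]xR^3 with sup_t
||u(t)||_{L^3} <= A (A>=2) obeys |u(t,x)| <= F(A) t^{-1/2}. Known F = exp exp exp(A^{O(1)}) (Tao
arXiv:1908.04958 Thm 1.2 = Literature.Analysis.FluidPDE.tao_quantitative_ess). Via the energy bridge
(||u||_3^3 <= ||u||_2^2 ||u||_inf) X => NoBlowup => Clay (A); conversely any blow-up forces F_*(A)
>= cA^3 for all large A. Heuristic sizes: linear regime F~A, one strained-vortex level F~A^{3/2}, n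
nested constant-Reynolds levels F~A^{1+n/2} (cubic = depth 4). Sources: Tao2021QuantitativeNS Rmk
1.5; BarkerPrange arXiv:2003.06717 sec.1.2; card subcubic-ess-bridge. (Route-repair 2026-08-15,
statement UNCHANGED up to Iff.rfl: Tao's class `Literature.Analysis.FluidPDE.IsHkClassicalSolutionOn
(Set.Icc 0 T) u p` (:= IsClassicalNSSolutionOn (Icc 0 T) 1 0 u p ∧ ∀ n, ∃ C, ∀ t ∈ Icc 0 T,
‖iteratedFDeriv ℝ n (u t)‖_{L²} ≤ C) written out definitionally so that PartialRegularity leaves the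
route's import cone; provers may convert with `Iff.rfl`/`id` to the named form.) -/
@[route_item "route-NavierStokesRegularity-SubcubicESS", crux]
def SubcubicBound : Prop :=
  ∃ F : ℝ → ℝ, (∀ ε : ℝ, 0 < ε → ∃ A₀ : ℝ, ∀ A : ℝ, A₀ ≤ A → F A ≤ ε * A ^ 3) ∧ ∀ (T A : ℝ) (u : ℝ → EuclideanSpace ℝ (Fin 3) → EuclideanSpace ℝ (Fin 3)) (p : ℝ → EuclideanSpace ℝ (Fin 3) → ℝ), (Literature.Analysis.FluidPDE.IsClassicalNSSolutionOn (Set.Icc 0 T) 1 0 u p ∧ ∀ n : ℕ, ∃ C : NNReal, ∀ t ∈ Set.Icc 0 T, MeasureTheory.eLpNorm (iteratedFDeriv ℝ n (u t)) 2 MeasureTheory.volume ≤ C) → (∀ t ∈ Set.Icc 0 T, MeasureTheory.eLpNorm (u t) 3 MeasureTheory.volume ≤ ENNReal.ofReal A) → 2 ≤ A → ∀ t ∈ Set.Ioc 0 T, ∀ x : EuclideanSpace ℝ (Fin 3), ‖u t x‖ ≤ F A * t ^ (-(1 / 2 : ℝ))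

/-- item stmt-NavierStokesRegularity-18288 · crux · rank 2 · open · by planner
why it might fail: Polynomial G may fail even on the line: only exp(O(1)B⁵) is known (Barker–Prange tie any gain to a vortex-stretching-reducing mechanism / Type-I exclusion); transient near-self-similar focusing over n ≫ (2b+2c)log₂A dyadic scales at bounded L³ (B grows like n^{1/5}) violates every admissible (b,c).
sources: arXiv:2003.06717 §1.2.2 pp.7-8 (Barker–Prange CMP 2021: G(x) ~ exp(O(1)x⁵) for finite-energy L⁵ solutions; G ~ x for small L⁵; improvement 'would have implications for the regularity theory (such as Type I blow-ups)'), arXiv:1908.04958 Rmk 1.5 (Tao 2021: exponential losses from pigeonholing/Carleman/scale counting), Hou2022PotentiallySingularNS = arXiv:2107.06509 (candidate transient focusing scenario), EscauriazaSereginSverak2003 Thm 1.3 (qualitative L³ endpoint), Literature.Analysis.FluidPDE.tao_quantitative_ess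
[crux] X₂ of the split of SubcubicBound (crux-strategist BC2 redirect 2026-08-17). QUINTIC SMOOTHING
ON THE ENERGY LINE: for some c > 0, b with b + (9/5)c ≤ 3 and a constant C, every Tao-class solution
on [0,T] with sup ‖u‖_{L³} ≤ A (A ≥ 2) and ∫_{t/2}^t∫|u|⁵ ≤ B⁵ obeys √t |u(t,x)| ≤ C A^b (1+B)^c.
This is the polynomial form of the quantitative LPS smoothing ‖u‖_{L^∞(ℝ³×(½,1))} ≤ G(‖u‖_{L⁵})
singled out by Barker–Prange (arXiv:2003.06717 §1.2.2: known G(x) ~ exp(O(1)x⁵) by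
enstrophy–Gronwall; 'substantially improving would most likely require a nonlinear mechanism that
reduces the influence of the vortex stretching term'), with the L³ level A as second parameter. WHY
THE LINE: the energy pays for 3 powers of the L³-amplitude and 5/3 powers of the L⁵-amplitude, so a
mixed bound with b + 9c/5 < 3 would close a DOUBLE energy bridge (A³ ≲ A^bB^c and B⁵ ≲
A^{2b+3}B^{2c}) and imply NoBlowup by itself; with ≤ 3 and c > 0 every witness can be pushed
(monotonicity in (b,c)) ONTO the line b + 9c/5 = 3, where exponents balance exactly and no bridge
closes — X₂ alone decides nothing, and it is not implied by SubcubicBound (that would need b ≥ 3).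
Only the regime B ≲ A^{9/5} is load-bearing fo -/
@[route_item "route-NavierStokesRegularity-SubcubicESS"]
def QuinticSmoothing : Prop :=
  ∃ C b c : ℝ, 0 < c ∧ b + 9 / 5 * c ≤ 3 ∧ ∀ (T A B : ℝ) (u : ℝ → EuclideanSpace ℝ (Fin 3) → EuclideanSpace ℝ (Fin 3)) (p : ℝ → EuclideanSpace ℝ (Fin 3) → ℝ), (Literature.Analysis.FluidPDE.IsClassicalNSSolutionOn (Set.Icc 0 T) 1 0 u p ∧ ∀ n : ℕ, ∃ C : NNReal, ∀ t ∈ Set.Icc 0 T, MeasureTheory.eLpNorm (iteratedFDeriv ℝ n (u t)) 2 MeasureTheory.volume ≤ C) → (∀ t ∈ Set.Icc 0 T, MeasureTheory.eLpNorm (u t) 3 MeasureTheory.volume ≤ ENNReal.ofReal A) → 2 ≤ A → 0 ≤ B → ∀ t ∈ Set.Ioc 0 T, (∫⁻ s in Set.Icc (t / 2) t, ∫⁻ x : EuclideanSpace ℝ (Fin 3), ‖u s x‖ₑ ^ (5 : ℕ)) ≤ ENNReal.ofReal (B ^ 5) → ∀ x : EuclideanSpace ℝ (Fin 3), ‖u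 t x‖ ≤ C * A ^ b * (1 + B) ^ c * t ^ (-(1 / 2 : ℝ))

-- earlier PolynomialBound (stmt-NavierStokesRegularity-1169, replaced 2026-08-15T16:20:58Z -> stmt-NavierStokesRegularity-10672): retired by None — ∃ C k : ℝ, ∀ (T A : ℝ) (u : ℝ → EuclideanSpace ℝ (Fin 3) → EuclideanSpace ℝ (Fin 3)) (p : ℝ → EuclideanSpace ℝ (Fin 3) → ℝ), Literature.Analysis.FluidPDE.IsHkClassicalSolutionOn (Set.Icc 0 T) u p → (∀ t ∈ Set.Icc 0 T, MeasureTheory.eLpNorm (u t) 3 Measur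
/-- item stmt-NavierStokesRegularity-10672 · crux · rank 3 · open · by planner
why it might fail: May be FALSE, not only hard: F_* could be super-polynomial — no rigorous lower bound beyond O(1) in print; heuristics: fat vortex ring at Re~A gives ~A, one strained level A^{3/2}, n nested constant-Re levels A^{1+n/2} with no known depth cap; above, each of Tao's 3 exps may be essential (Rmk 1.5).
sources: arXiv:1908.04958 Rmk 1.5 (p.6), arXiv:2101.08586 Thm 1 + Rmk 1 + discussion (p.4) (Palasek ARMA 2021: exp exp(A^{O(1)}) for axisymmetric u, q = 3: pigeonholing avoided by axisymmetric Bernstein, Carleman and scale counting remain), arXiv:2003.06717 sec.1.2.2 p.8 (G ~ exp(O(1)x^5) for L^5_{t,x} by enstrophy-Gronwall; improving 'would most likely require ... a nonlinear mechanism that reduces vortex stretching'), arXiv:2209.15627 (Barker 2023, localized quantitative estimates), arXiv:2602.09951 p.2 (2026 state of the art and list of refinements), card NavierStokesRegularity/NavierStokesRegularity/subcubic-ess-bridge (cascade heuristic F ~ A^{1+n/2})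
[crux] Rung (milestone, implied by X with k=3): POLYNOMIAL quantitative ESS with some exponent:
exists C,k with |u(t,x)| <= C A^k t^{-1/2} for Tao-class solutions with L^inf_t L^3_x <= A. Known:
triple exponential (Tao 2021 Thm 1.2); double exponential in Palasek's axis-weighted/axisymmetric
scale (arXiv:2101.08586); for L^5_{t,x} the analogous G is exp(cA^5) by enstrophy-Gronwall
(Barker-Prange arXiv:2003.06717 sec.1.2.2, 'improving it would most likely require a nonlinear
mechanism reducing vortex stretching'). Programme (layer 2, not filed): polynomial-cost
frequency-localised epsilon-regularity along Tao's bubble chain (O(log A) steps) + Gaussian-free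
quantitative backward uniqueness across an annulus. (Route-repair 2026-08-15, statement UNCHANGED up
to Iff.rfl: Tao's class `IsHkClassicalSolutionOn (Set.Icc 0 T) u p` written out definitionally so
that PartialRegularity leaves the route's import cone; provers may convert with `Iff.rfl`/`id` to
the named form.) -/
@[route_item "route-NavierStokesRegularity-SubcubicESS"]
def PolynomialBound : Prop :=
  ∃ C k : ℝ, ∀ (T A : ℝ) (u : ℝ → EuclideanSpace ℝ (Fin 3) → EuclideanSpace ℝ (Fin 3)) (p : ℝ → EuclideanSpace ℝ (Fin 3) → ℝ), (Literature.Analysis.FluidPDE.IsClassicalNSSolutionOn (Set.Icc 0 T) 1 0 u p ∧ ∀ n : ℕ, ∃ C : NNReal, ∀ t ∈ Set.Icc 0 T, MeasureTheory.eLpNorm (iteratedFDeriv ℝ n (u t)) 2 MeasureTheory.volume ≤ C) → (∀ t ∈ Set.Icc 0 T, MeasureTheory.eLpNorm (u t) 3 MeasureTheory.volume ≤ ENNReal.ofReal A) → 2 ≤ A → ∀ t ∈ Set.Ioc 0 T, ∀ x : EuclideanSpace ℝ (Fin 3), ‖u t x‖ ≤ C * A ^ k * t ^ (-(1 / 2 :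 ℝ))

/-- item stmt-NavierStokesRegularity-18289 · crux · rank 3 · open · by planner
why it might fail: May be false with SubcubicBound true: X forces only the price a=9/5; repeated small-scale intense epochs (L³-content ~A, L⁵-contribution ~A per viscous lifetime) fed by an uncontrolled large-scale energy reservoir could give ∫∫|u|⁵ ~ K·A⁵ with K unbounded in A; known: only Tao's triple exp.
sources: arXiv:1908.04958 Thm 1.2, Rmk 1.5 (Tao 2021: the only quantitative control of Tao-class solutions, triple exponential), arXiv:2003.06717 §1.2.2 pp.7-8 (Barker–Prange CMP 2021: L⁵_{t,x} as the model critical spacetime norm; G(x) ~ exp(O(1)x⁵); small L⁵ is linear), Literature.Analysis.FluidPDE.tao_quantitative_ess, strategist evidence Split.lean: subcubicESS_quinticNormDiscount_of_polynomialBound (X₁ ⟸ polynomial sub-cubic ESS)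
[crux] X₁ of the split of SubcubicBound through the critical spacetime L⁵ norm (crux-strategist BC2
redirect 2026-08-17). QUINTIC NORM DISCOUNT: for some exponent a < 9/5 and constant C, every
Tao-class solution of unforced NS (ν=1, all Sobolev norms bounded) on [0,T]×ℝ³ with sup_{[0,T]}
‖u‖_{L³} ≤ A, A ≥ 2, has ∫_{t/2}^{t} ∫_{ℝ³} |u|⁵ dx ds ≤ C A^{5a} for every t ∈ (0,T]. The half-slab
L⁵_{t,x} norm is the symmetric Ladyzhenskaya–Prodi–Serrin quantity; A^{9/5} is its ENERGY PRICE
(what a cubic velocity bound forces through ∫|u|⁵ ≤ ‖u‖_∞²∫|u|³). X₁ says critically bounded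
solutions are strictly L⁵-cheaper than that. It is implied by ANY polynomial sub-cubic ESS bound |u|
≤ C A^k t^{-1/2}, k<3 (a = (2k⁺+3)/5; proved: subcubicESS_quinticNormDiscount_of_polynomialBound in
the strategist's Split.lean, attached as evidence), but not by SubcubicBound itself (o(A³) only
returns the price 9/5), and alone it decides nothing (after B ≤ C A^a only the known exp(O(1)B⁵)
smoothing is available: no energy bridge closes). Known: nothing polynomial — Tao's triple
exponential gives ∫∫|u|⁵ ≤ exp exp exp(A^{O(1)}); linear floor a ≥ 1 (heat flow:
‖e^{sΔ}u₀‖_{L⁵_{s,x}} ≲ ‖u₀‖_{L³}). Assembly with X₂ = -/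
@[route_item "route-NavierStokesRegularity-SubcubicESS"]
def QuinticNormDiscount : Prop :=
  ∃ C a : ℝ, a < 9 / 5 ∧ ∀ (T A : ℝ) (u : ℝ → EuclideanSpace ℝ (Fin 3) → EuclideanSpace ℝ (Fin 3)) (p : ℝ → EuclideanSpace ℝ (Fin 3) → ℝ), (Literature.Analysis.FluidPDE.IsClassicalNSSolutionOn (Set.Icc 0 T) 1 0 u p ∧ ∀ n : ℕ, ∃ C : NNReal, ∀ t ∈ Set.Icc 0 T, MeasureTheory.eLpNorm (iteratedFDeriv ℝ n (u t)) 2 MeasureTheory.volume ≤ C) → (∀ t ∈ Set.Icc 0 T, MeasureTheory.eLpNorm (u t) 3 MeasureTheory.volume ≤ ENNReal.ofReal A) → 2 ≤ A → ∀ t ∈ Set.Ioc 0 T, ∫⁻ s in Set.Icc (t / 2) t, ∫⁻ x : EuclideanSpace ℝ (Fin 3), ‖u s x‖ₑ ^ (5 : ℕ) ≤ ENNReal.ofReal (C * A ^ (5 * a))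

-- earlier AxisymSubcubicBound (stmt-NavierStokesRegularity-1170, replaced 2026-08-15T16:20:58Z -> stmt-NavierStokesRegularity-10673): retired by None — ∃ F : ℝ → ℝ, (∀ ε : ℝ, 0 < ε → ∃ A₀ : ℝ, ∀ A : ℝ, A₀ ≤ A → F A ≤ ε * A ^ 3) ∧ ∀ (T A : ℝ) (u : ℝ → EuclideanSpace ℝ (Fin 3) → EuclideanSpace ℝ (Fin 3)) (p : ℝ → EuclideanSpace ℝ (Fin 3) → ℝ), Literature.Analysis.FluidPDE.IsHkClassicalSolutionOn (Set.
/-- item stmt-NavierStokesRegularity-10673 · crux · rank 4 · open · by planner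
why it might fail: Stronger than the OPEN axisymmetric-with-swirl regularity (adds a rate); KNSS: axisymmetric singularities are Type II with ‖u(t)‖₃→∞, so no Type-I/Liouville shortcut caps amplification below A³; Hou's axisymmetric scenario would force F≥cA³ here; record: exp exp(A^{O(1)}) (Palasek Thm 1, q=3).
sources: arXiv:2101.08586 Thm 1, Rmk 1 and the q = 3 paragraph (p.4) (Palasek: |u| ≤ exp exp(A^{O(1)}) t^{-1/2} for axisymmetric L^inf_t L^3; 'one fewer exp or log than [Tao]'), KNSS2009 = arXiv:0709.3599 (axisymmetric singularities are Type II; ru ∈ L^inf ⇒ regular), Hou2022PotentiallySingularNS = arXiv:2107.06509, Hou2026 (FoCM 2026: nearly self-similar blowup of generalized axisymmetric NS), arXiv:2210.10030 (Ozanski-Palasek 2023: axisymmetric weak-L^3 quantitative control), Literature.Analysis.FluidPDE.AxisymmetricSwirlRegularity (open; would follow from this rung via the bridge + IsTaoSolutionOn.conj_eq_of_datum)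
[crux] Rung: X restricted to axisymmetric Tao-class solutions
(Literature.Analysis.FluidPDE.IsAxisymmetric (u t) for all t). Known: |u| <= exp exp(A^{O(1)})
t^{-1/2} (Palasek arXiv:2101.08586 Thm 1, q=3 axisymmetric case: one exponential fewer than Tao
because axisymmetric Bernstein inequalities avoid the pigeonholing). Value: through the same energy
bridge restricted to axisymmetric data plus propagation of axisymmetry in Tao's class
(IsTaoSolutionOn.conj_eq_of_datum, proved) it would settle
Literature.Analysis.FluidPDE.AxisymmetricSwirlRegularity (axisymmetric-with-swirl global regularity,
open); the axisymmetric assembly is deliberately not filed yet. (Route-repair 2026-08-15, statement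
UNCHANGED up to Iff.rfl: `IsHkClassicalSolutionOn` and `Literature.Analysis.FluidPDE.IsAxisymmetric
(u t)` (:= ∀ θ x, u t (rotZ θ x) = rotZ θ (u t x), rotZ θ x = toLp 2 ![cos θ x₀ − sin θ x₁, sin θ x₀
+ cos θ x₁, x₂]) written out definitionally so that PartialRegularity / AxisymmetricEuler leaves the
route's import cone; provers may convert with `Iff.rfl`/`id` to the named form.) -/
@[route_item "route-NavierStokesRegularity-SubcubicESS"]
def AxisymSubcubicBound : Prop :=
  ∃ F : ℝ → ℝ, (∀ ε : ℝ, 0 < ε → ∃ A₀ : ℝ, ∀ A : ℝ, A₀ ≤ A → F A ≤ ε * A ^ 3) ∧ ∀ (T A : ℝ) (u : ℝ → EuclideanSpace ℝ (Fin 3) → EuclideanSpace ℝ (Fin 3)) (p : ℝ → EuclideanSpace ℝ (Fin 3) → ℝ), (Literature.Analysis.FluidPDE.IsClassicalNSSolutionOn (Set.Icc 0 T) 1 0 u p ∧ ∀ n : ℕ, ∃ C : NNReal, ∀ t ∈ Set.Icc 0 T, MeasureTheory.eLpNorm (iteratedFDeriv ℝ n (u t)) 2 MeasureTheory.volume ≤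 C) → (∀ t ∈ Set.Icc 0 T, ∀ (θ : ℝ) (x : EuclideanSpace ℝ (Fin 3)), u t (WithLp.toLp 2 ![Real.cos θ * x 0 - Real.sin θ * x 1, Real.sin θ * x 0 + Real.cos θ * x 1, x 2]) = WithLp.toLp 2 ![Real.cos θ * u t x 0 - Real.sin θ * u t x 1, Real.sin θ * u t x 0 + Real.cos θ * u t x 1, u t x 2]) → (∀ t ∈ Set.Icc 0 T, MeasureTheory.eLpNorm (u t) 3 MeasureTheory.volume ≤ ENNReal.ofReal A) → 2 ≤ A → ∀ t ∈ Set.Ioc 0 T, ∀ x : EuclideanSpace ℝ (Fin 3), ‖u t x‖ ≤ F A * t ^ (-(1 / 2 : ℝ))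

-- earlier SelfSimilarSubcubicBound (stmt-NavierStokesRegularity-1171, replaced 2026-08-15T16:20:58Z -> stmt-NavierStokesRegularity-10674): retired by None — ∃ F : ℝ → ℝ, (∀ ε : ℝ, 0 < ε → ∃ A₀ : ℝ, ∀ A : ℝ, A₀ ≤ A → F A ≤ ε * A ^ 3) ∧ ∀ (A : ℝ) (u₀ : EuclideanSpace ℝ (Fin 3) → EuclideanSpace ℝ (Fin 3)) (u : ℝ → EuclideanSpace ℝ (Fin 3) → EuclideanSpace ℝ (Fin 3)) (p : ℝ → EuclideanSpace ℝ (Fin 3) → 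
/-- item stmt-NavierStokesRegularity-10674 · crux · rank 5 · open · by planner
why it might fail: poly(A) expected (JS2014 Thm 4.1 proof at order 0; far field KMT Thm 1.1/BP Thm 3; L^∞ data off 0 is enough), o(A³) open: a (−1)-homogeneous strain ~A can hold a Burgers-type vortex in the steady Leray profile (‖U‖_∞~A^{3/2}), deeper nesting uncapped; large-A profiles bifurcate (JS2015, GS2023).
sources: JiaSverak2014 = arXiv:1204.0529: Thm 4.1 = 'Theorem 6' p.9 (a-priori profile bound; constants depend on u0 and finitely many derivatives on S^2; proof = Lemma 5 local energy + Thm 3.1 far field + bootstrap), Thm 3.1 = 'Theorem 4' p.7 (data in L^m(B_2), m > 3), KangMiuraTsai2020 = arXiv:1812.10509 Thm 1.1 (p.3: ‖v0‖_{L^3(B_1)} ≤ ε0 and dimension-1 local energy ≤ M ⇒ |v| ≤ C1/√t on B_{1/4}×(0,T1), T1 = ε(1+M)^{-6}, C1 independent of M) and Def 3.2 (the vendored IsLocalLeraySolution), arXiv:2003.06717 Thm 3 p.26 (Barker-Prange: ‖u‖_{L^inf(B(1/2)×(3S*/4,S*))} ≤ C* M^8 N^19, S* = O(1) M^-30 N^-70),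 JiaSverak2015 (bifurcation / non-uniqueness scenario for large self-similar data), GuillodSverak2023 (numerics: non-unique self-similar profiles), BradshawTsai2017AHP (self-similar/DSS local Leray solutions for rough (-1)-homogeneous / weak-L^3 data: the class quantified over is non-empty beyond Hölder data)
[crux] Toy rung = Jia-Sverak arXiv:1204.0529 Thm 4.1 QUANTIFIED: for every scale-invariant
(IsSelfSimilar) local Leray solution (IsLocalLeraySolution 1 u0 u p) whose datum obeys |x||u0(x)| <=
A, ess-sup |u(t)| <= F(A) t^{-1/2} with F = o(A^3); since u(t,x) = t^{-1/2}U(x/t^{1/2}) this is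
||U||_inf <= F(A): the exact analogue of F_* with the L^3 history replaced by the weak-L^3 size of a
(-1)-homogeneous datum. Jia-Sverak's a-priori constant C(M) (local energy inequality +
local-in-space regularity near t=0) is untracked; Korobkov-Tsai-type bounds are by contradiction.
First milestone (expected provable, to be filed as support once this item is stamped): a POLYNOMIAL
F from Barker-Prange arXiv:2003.06717 Thm 3 (local smoothing ||u|| <= C M^8 N^19 on B(1/2)x(3S/4,S),
S ~ M^{-30}N^{-70}) for the far field |y| >~ A^{50} + explicit elliptic bootstrap for the Leray
system -Delta U - U/2 - y.grad U/2 + U.grad U + grad P = 0 on the near field with H^1(B_R) <=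
poly(A) from the local energy inequality. Self-similar local Leray solutions are smooth for t>0
(CKN: the singular set is scale-invariant and P^1-null), so the ess-sup is the sup of the smooth
representative. (Route-repair 2026-08-15, -/
@[route_item "route-NavierStokesRegularity-SubcubicESS"]
def SelfSimilarSubcubicBound : Prop :=
  ∃ F : ℝ → ℝ, (∀ ε : ℝ, 0 < ε → ∃ A₀ : ℝ, ∀ A : ℝ, A₀ ≤ A → F A ≤ ε * A ^ 3) ∧ ∀ (A : ℝ) (u₀ : EuclideanSpace ℝ (Fin 3) → EuclideanSpace ℝ (Fin 3)) (u : ℝ → EuclideanSpace ℝ (Fin 3) → EuclideanSpace ℝ (Fin 3)) (p : ℝ → EuclideanSpace ℝ (Fin 3) → ℝ), Literature.Analysis.FluidPDE.IsLocalLeraySolution 1 u₀ u p → (∀ c : ℝ, 0 < c → (fun (t : ℝ) (x : EuclideanSpace ℝ (Fin 3)) => c • u (c ^ 2 * t) (c • x)) = u) → (∀ x : EuclideanSpace ℝ (Fin 3), ‖x‖ * ‖u₀ x‖ ≤ A) → 2 ≤ A → ∀ t : ℝ, 0 < t → MeasureTheory.eLpNorm (u t) ⊤ MeasureTheory.volume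 ≤ ENNReal.ofReal (F A * t ^ (-(1 / 2 : ℝ)))

/-- item stmt-NavierStokesRegularity-0055 · support · rank 9 · closed · proved by Summit.NavierStokesRegularity.NavierStokesRegularity.Theorems.typeICertificateLadder_noBlowupToClay_proof @ 8d57e70af7e2 (prover) · by planner
Given NoBlowup, build the Clay (A) solution: local finite-energy classical solution for smooth
divergence-free rapidly decaying data (Leray 1934 §III / Fujita–Kato 1964 + LPS smoothing), continue
past every T using NoBlowup, glue by weak–strong uniqueness (Prodi–Serrin), bounded energy from the
energy inequality, and convert with
Literature.Analysis.FluidPDE.isNavierStokesSolution_and_smooth_iff. Blow-up at spatial infinity is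
excluded by CKN ε-regularity applied far out. May take named Literature facts (leray_existence_R3,
ladyzhenskaya_prodi_serrin, weak_strong_uniqueness, fujita_kato_local) as hypotheses if the grounder
so rules. -/
@[route_item "route-NavierStokesRegularity-SubcubicESS", crux]
def NoBlowupToClay : Prop :=
  (∀ (ν T : ℝ), 0 < ν → 0 < T → ∀ (u : ℝ → EuclideanSpace ℝ (Fin 3) → EuclideanSpace ℝ (Fin 3)) (p : ℝ → EuclideanSpace ℝ (Fin 3) → ℝ), Literature.Analysis.FluidPDE.IsClassicalNSSolutionOn (Set.Ico 0 T) ν 0 u p → Literature.Analysis.FluidPDE.IsLerayHopfOn T ν 0 (u 0) u → Literature.Analysis.FluidPDE.HasRapidSpatialDecay (u 0) → Literature.Analysis.FluidPDE.HasSmoothExtensionPast ν 0 u T) → NavierStokesRegularity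

/-- `NoBlowupToClay` holds: proved by `Summit.NavierStokesRegularity.NavierStokesRegularity.Theorems.typeICertificateLadder_noBlowupToClay_proof` @ 8d57e70af7e2. -/
theorem NoBlowupToClay_holds : NoBlowupToClay := _root_.Summit.NavierStokesRegularity.NavierStokesRegularity.Theorems.typeICertificateLadder_noBlowupToClay_proof

-- earlier EnergyBridge (stmt-NavierStokesRegularity-1172, replaced 2026-08-15T16:20:58Z -> stmt-NavierStokesRegularity-10675): retired by None — (∃ F : ℝ → ℝ, (∀ ε : ℝ, 0 < ε → ∃ A₀ : ℝ, ∀ A : ℝ, A₀ ≤ A → F A ≤ ε * A ^ 3) ∧ ∀ (T A : ℝ) (u : ℝ → EuclideanSpace ℝ (Fin 3) → EuclideanSpace ℝ (Fin 3)) (p : ℝ → EuclideanSpace ℝ (Fin 3) → ℝ), Literature.Analysis.FluidPDE.IsHkClassicalSolutionOn (Set.Icc 0 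
/-- item stmt-NavierStokesRegularity-10675 · support · rank 9 · closed · proved by Summit.NavierStokesRegularity.NavierStokesRegularity.Theorems.subcubicESS_energyBridge_proof (prover) · by planner
[support] THE BRIDGE (provable now, ~150 lines on the NSCriticalClosureTao2021 template): X -> every
classical solution on [0,T) with viscosity nu>0, Leray-Hopf from its rapidly decaying datum, has
sup_{[0,T)} ||u(t)||_3 < inf. Proof: t0 := T/2; for T' in (t0,T) restrict to Icc 0 T'
(IsClassicalNSSolutionOn.mono, uniqueDiffOn_Icc); energy: lintegral |u t|^2 <= ofReal(2 E(u 0))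
(IsLerayHopfOn.lintegral_enorm_sq_le); Tao class on [0,T'] by
tao2011_hasBoundedSobolevNormsOn_holds, so N(T') := sup_{[0,T']} ||u||_3 < inf (L^2 cap L^inf,
linfty_bound_of_hasBoundedSobolevNormsOn_holds); rescale w(s,x) = nu^{-1} u(s/nu, x)
(IsClassicalNSSolutionOn.viscosityRescale_zero, copy norm_le_of_tao_quantitative with taoTripleExp C
-> F): |u(t,x)| <= nu F(A) (nu t)^{-1/2}, A = max(2, nu^{-1}N(T')); Hoelder ||u(t)||_3^3 <=
||u(t)||_2^2 ||u(t)||_inf gives for t in [t0,T']: (nu^{-1}||u(t)||_3)^3 <= K F(A), K := 2E(u0)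
nu^{-5/2} t0^{-1/2}; hence A' := nu^{-1}N(T') <= max(2, nu^{-1}N(t0)) or A'^3 <= K F(A'); with eps =
1/(2K) in the o(A^3) clause, A' <= max(2, nu^{-1}N(t0), A0(eps)) uniformly in T' < T. Sources: card;
Tao2021QuantitativeNS; Seregin2012. (Route-repair 2026-08-15, statement UNCHANGED up to -/
@[route_item "route-NavierStokesRegularity-SubcubicESS", crux]
def EnergyBridge : Prop :=
  (∃ F : ℝ → ℝ, (∀ ε : ℝ, 0 < ε → ∃ A₀ : ℝ, ∀ A : ℝ, A₀ ≤ A → F A ≤ ε * A ^ 3) ∧ ∀ (T A : ℝ) (u : ℝ → EuclideanSpace ℝ (Fin 3) → EuclideanSpace ℝ (Fin 3)) (p : ℝ → EuclideanSpace ℝ (Fin 3) → ℝ), (Literature.Analysis.FluidPDE.IsClassicalNSSolutionOn (Set.Icc 0 T) 1 0 u p ∧ ∀ n : ℕ, ∃ C : NNReal, ∀ t ∈ Set.Icc 0 T, MeasureTheory.eLpNorm (iteratedFDeriv ℝ n (u t)) 2 MeasureTheory.volume ≤ C) → (∀ t ∈ Set.Icc 0 T, MeasureTheory.eLpNorm (u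 t) 3 MeasureTheory.volume ≤ ENNReal.ofReal A) → 2 ≤ A → ∀ t ∈ Set.Ioc 0 T, ∀ x : EuclideanSpace ℝ (Fin 3), ‖u t x‖ ≤ F A * t ^ (-(1 / 2 : ℝ))) → ∀ (ν T : ℝ), 0 < ν → 0 < T → ∀ (u : ℝ → EuclideanSpace ℝ (Fin 3) → EuclideanSpace ℝ (Fin 3)) (p : ℝ → EuclideanSpace ℝ (Fin 3) → ℝ), Literature.Analysis.FluidPDE.IsClassicalNSSolutionOn (Set.Ico 0 T) ν 0 u p → Literature.Analysis.FluidPDE.IsLerayHopfOn T ν 0 (u 0) u → Literature.Analysis.FluidPDE.HasRapidSpatialDecay (u 0) → (⨆ t ∈ Set.Ico 0 T, MeasureTheory.eLpNorm (u t) 3 MeasureTheory.volume) < ⊤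

-- `EnergyBridge` holds: proved by `Summit.NavierStokesRegularity.NavierStokesRegularity.Theorems.subcubicESS_energyBridge_proof` (its module imports this route file, so no `_holds` link can be stated here).

-- earlier UniformESSClosure (stmt-NavierStokesRegularity-1173, replaced 2026-08-15T16:20:58Z -> stmt-NavierStokesRegularity-10676): retired by None — (∃ F : ℝ → ℝ, ∀ (T A : ℝ) (u : ℝ → EuclideanSpace ℝ (Fin 3) → EuclideanSpace ℝ (Fin 3)) (p : ℝ → EuclideanSpace ℝ (Fin 3) → ℝ), Literature.Analysis.FluidPDE.IsHkClassicalSolutionOn (Set.Icc 0 T) u p → (∀ t ∈ Set.Icc 0 T, MeasureTheory.eLpNorm (u t) 3 M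
/-- item stmt-NavierStokesRegularity-10676 · support · rank 9 · closed · proved by Summit.NavierStokesRegularity.NavierStokesRegularity.Theorems.subcubicESS_uniformESSClosure_proof (prover) · by planner
[support] (provable now) A uniform velocity-only ESS bound in Tao's class with ANY size function F
(exists F, for all T A u p, Hk-class on [0,T], ||u(t)||_3 <= A, A >= 2 => |u(t,x)| <= F(A) t^{-1/2})
implies the L^3 continuation criterion
Literature.Analysis.FluidPDE.hasSmoothExtensionPast_of_eLpNorm_three_bounded. Proof = the marching
argument of hasSmoothExtensionPast_of_eLpNorm_three_bounded_of_tao2021'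
(NSCriticalClosureTao2021.lean) verbatim with taoTripleExp Cq replaced by F: that proof reads only
the velocity clause `.1` of Tao's conclusion (norm_le_of_tao_quantitative); the local H^1 theory and
weak-strong uniqueness are theorems (tao2011_smooth_local_existence_holds,
serrin_weak_strong_uniqueness_holds). Strictly generalises the proved ..._of_tao2021. Sources:
Tao2021QuantitativeNS Thm 1.1/1.2; EscauriazaSereginSverak2003 Thm 1.3; Seregin2012. (Route-repair
2026-08-15, statement UNCHANGED up to Iff.rfl: `IsHkClassicalSolutionOn` in the premise and the
CONCLUSION `Literature.Analysis.FluidPDE.hasSmoothExtensionPast_of_eLpNorm_three_bounded` written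
out as its defining body (∀ ν T > 0, classical on Ico 0 T + Leray–Hopf from a rapidly decaying datum
+ ⨆_{t<T} ‖u t‖₃ < ⊤ ⇒ Has -/
@[route_item "route-NavierStokesRegularity-SubcubicESS", crux]
def UniformESSClosure : Prop :=
  (∃ F : ℝ → ℝ, ∀ (T A : ℝ) (u : ℝ → EuclideanSpace ℝ (Fin 3) → EuclideanSpace ℝ (Fin 3)) (p : ℝ → EuclideanSpace ℝ (Fin 3) → ℝ), (Literature.Analysis.FluidPDE.IsClassicalNSSolutionOn (Set.Icc 0 T) 1 0 u p ∧ ∀ n : ℕ, ∃ C : NNReal, ∀ t ∈ Set.Icc 0 T, MeasureTheory.eLpNorm (iteratedFDeriv ℝ n (u t)) 2 MeasureTheory.volume ≤ C) → (∀ t ∈ Set.Icc 0 T, MeasureTheory.eLpNorm (u t) 3 MeasureTheory.volume ≤ ENNReal.ofReal A) → 2 ≤ A → ∀ t ∈ Set.Ioc 0 T, ∀ x : EuclideanSpace ℝ (Fin 3), ‖u t x‖ ≤ F A * t ^ (-(1 / 2 : ℝ))) → ∀ (ν T : ℝ), 0 < ν → 0 < T → ∀ (u : ℝ → EuclideanSpace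 ℝ (Fin 3) → EuclideanSpace ℝ (Fin 3)) (p : ℝ → EuclideanSpace ℝ (Fin 3) → ℝ), Literature.Analysis.FluidPDE.IsClassicalNSSolutionOn (Set.Ico 0 T) ν 0 u p → Literature.Analysis.FluidPDE.IsLerayHopfOn T ν 0 (u 0) u → Literature.Analysis.FluidPDE.HasRapidSpatialDecay (u 0) → (⨆ t ∈ Set.Ico 0 T, MeasureTheory.eLpNorm (u t) 3 MeasureTheory.volume) < ⊤ → Literature.Analysis.FluidPDE.HasSmoothExtensionPast ν 0 u T

-- `UniformESSClosure` holds: proved by `Summit.NavierStokesRegularity.NavierStokesRegularity.Theorems.subcubicESS_uniformESSClosure_proof` (its module imports this route file, so no `_holds` link can be stated here).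

/-- item stmt-NavierStokesRegularity-18399 · support · rank 9 · closed · proved by Summit.NavierStokesRegularity.NavierStokesRegularity.Theorems.subcubicESS_quinticSplitGlue_proof (prover) · by planner
sources: strategist Split.lean (Cruxes/SubcubicBound/Split.lean): subcubicESS_subcubicBound_of_quintic, arXiv:2003.06717 §1.2.2, arXiv:1908.04958 Thm 1.2
[support] GLUE of the crux-strategist decomposition of the deciding crux SubcubicBound (BC2
redirect, 2026-08-17; `route edit --split` is final-cycle-only, so the decomposition is filed flat,
as on route SqueezeCycle): QuinticNormDiscount → QuinticSmoothing → SubcubicBound. PROVABLE NOW — in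
fact PROVED: theorem subcubicESS_subcubicBound_of_quintic in the strategist's Split.lean (crux
workfile Cruxes/SubcubicBound/Split.lean, evidence on stmt-NavierStokesRegularity-10671; lean rc0, 0
sorry, axioms standard), with both pieces inlined verbatim, so this item is closed by `fun h₁ h₂ =>
subcubicESS_subcubicBound_of_quintic h₁ h₂` once a prover lands that file as
Theorems/SubcubicESSSubcubicBoundSplit.lean (Theorems/ is prover-only). Proof (≈75 lines of
real-power bookkeeping, not a one-line seam): from X₁ take (C₁,a), a⁺ := max(a,0) < 9/5, B(A) :=
(|C₁|A^{5a⁺})^{1/5}, so ∫_{t/2}^t∫|u|⁵ ≤ C₁A^{5a} ≤ B(A)⁵ for A ≥ 2; from X₂ take (C₂,b,c) and set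
F(A) := C₂A^b(1+B(A))^c — the velocity clause of SubcubicBound is X₂ at level B(A); and 1+B(A) ≤
2max(1,|C₁|^{1/5})A^{a⁺} for A ≥ 1 gives F(A) ≤ K A^{b+a⁺c} with b + a⁺c < b + (9/5)c ≤ 3 (c > 0),
whence F(A) ≤ εA³ for A ≥ max(1,(K/ε)^{1/(3−b−a⁺c) -/
@[route_item "route-NavierStokesRegularity-SubcubicESS"]
def QuinticSplitGlue : Prop :=
  Summit.NavierStokesRegularity.NavierStokesRegularity.Theses.SubcubicESS.QuinticNormDiscount → Summit.NavierStokesRegularity.NavierStokesRegularity.Theses.SubcubicESS.QuinticSmoothing → Summit.NavierStokesRegularity.NavierStokesRegularity.Theses.SubcubicESS.SubcubicBound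

-- `QuinticSplitGlue` holds: proved by `Summit.NavierStokesRegularity.NavierStokesRegularity.Theorems.subcubicESS_quinticSplitGlue_proof` (its module imports this route file, so no `_holds` link can be stated here).

-- earlier Assembly (stmt-NavierStokesRegularity-1174, replaced 2026-08-15T16:20:58Z -> stmt-NavierStokesRegularity-10677): retired by None — (∃ F : ℝ → ℝ, (∀ ε : ℝ, 0 < ε → ∃ A₀ : ℝ, ∀ A : ℝ, A₀ ≤ A → F A ≤ ε * A ^ 3) ∧ ∀ (T A : ℝ) (u : ℝ → EuclideanSpace ℝ (Fin 3) → EuclideanSpace ℝ (Fin 3)) (p : ℝ → EuclideanSpace ℝ (Fin 3) → ℝ), Literature.Analysis.FluidPDE.IsHkClassicalSolutionOn (Set.Icc 0 T) u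
/-- item stmt-NavierStokesRegularity-10677 · assembly · rank 1 · closed · proved by Summit.NavierStokesRegularity.NavierStokesRegularity.Theorems.subcubicESS_assembly_proof @ 67f4302eac41 (prover) · by planner
[assembly] SubcubicBound → EnergyBridge → UniformESSClosure → NoBlowupToClay →
NavierStokesRegularity, BY ITEM NAME (route-repair 2026-08-15: the rev-2 text inlined the items'
bodies, which the glue lint read as extra hypotheses; unchanged up to Iff.rfl). PURE LOGIC, 6 lines
— it is literally the deciding theorem `closes` of this file (from X take F; UniformESSClosure ⟨F,
velocity clause⟩ is the L³ criterion; EnergyBridge X bounds ⨆_{t<T}‖u(t)‖₃ for every classical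
Leray–Hopf solution from a decaying datum; hence HasSmoothExtensionPast for all ν,T>0, the premise
of NoBlowupToClay). A prover closes it by `fun hX hB hE hC => closes hX hC hB hE` once the file is
imported, or by copying the proof of `closes`. -/
@[route_item "route-NavierStokesRegularity-SubcubicESS"]
def Assembly : Prop :=
  SubcubicBound → EnergyBridge → UniformESSClosure → NoBlowupToClay → NavierStokesRegularity

-- `Assembly` holds: proved by `Summit.NavierStokesRegularity.NavierStokesRegularity.Theorems.subcubicESS_assembly_proof` @ 67f4302eac41 (its module imports this route file, so no `_holds` link can be stated here).

/-! D-0027 §2.1 — DECIDING THEOREM (planner-authored via `route open/edit --closes-file`; by planner-rbadge-NavierStokesRegularity-Subcubic-4eab406a-g2-0 2026-08-15T16:20:58Z):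
its hypotheses are this route's items and its conclusion the sub-problem Statement (glue_lint), and it elaborates with this file. -/

/-- DECIDING THEOREM (D-0027 §2.1), pure logic. From `SubcubicBound` take the size function `F` with its velocity
clause; `UniformESSClosure ⟨F, ·⟩` is the `L³` continuation criterion for classical Leray–Hopf solutions from rapidly
decaying data; `EnergyBridge` turns `SubcubicBound` into the uniform bound `⨆_{t<T} ‖u(t)‖₃ < ⊤` for every such
solution; together they give `HasSmoothExtensionPast ν 0 u T` for all `ν, T > 0` (no first blow-up time), which is
exactly the premise of `NoBlowupToClay` (= shared stmt-NavierStokesRegularity-0055). The rungs `PolynomialBound`,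
`AxisymSubcubicBound`, `SelfSimilarSubcubicBound` are milestones toward `SubcubicBound` and are not hypotheses. -/
@[closes "route-NavierStokesRegularity-SubcubicESS"] theorem closes (hX : SubcubicBound) (hClay : NoBlowupToClay) (hBridge : EnergyBridge)
    (hESS : UniformESSClosure) : NavierStokesRegularity := by
  obtain ⟨F, hF, hvel⟩ := hX
  have hcrit := hESS ⟨F, hvel⟩
  have hsup := hBridge ⟨F, hF, hvel⟩
  exact hClay fun ν T hν hT u p hcl hLH hdec =>
    hcrit ν T hν hT u p hcl hLH hdec (hsup ν T hν hT u p hcl hLH hdec)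

end Summit.NavierStokesRegularity.NavierStokesRegularity.Theses.SubcubicESS
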